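import Summits.QuantumFields.QCD.Theorems.ExtinctionBuildsQCD.Negative.VolumeLeverBox

/-!
# Negative knowledge for the RESTATED crux `ExtinctionBuildsQCD` (stmt-QuantumFields-17572):
# the bridge is its own conclusion modulo junk witnesses of `SD`

Refuter crux-attack seat `refuter-rattack-stmt-QuantumFields-17572-0`, 2026-08-16. Supports
stmt-QuantumFields-17572; asserts no route item (every statement about a route decl is a definitional
unfolding, or an equivalence under hypotheses).

Route restate rev 6 (re-type repair p117723) changed only the CONCLUSION of the bridge: from `QCDOf N_f`
(strengthened by `reg.IsChiralAtZero` in the statement re-type) to the threshold body `THR(N_f)` —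
massive QCD above some threshold `M₁ ≥ 0` along some mass-scaling regularisation, verbatim the antecedent
of the proved support `ThresholdForm` and of the new crux `ChiralDescent`. The HYPOTHESIS `SD(N_f)`
(`Negative.SDHyp`: EXTINCT ∧ TIGHT above `M₀` on ONE asymptotically scaling, mass-scaling regularisation,
volumes uncapped) is untouched, so the junk-witness analysis of `WithoutTightCollapse.lean` (§2: EXTINCT is
free for a line at `m_crit ≥ 0`, witness `canonicalAF`) and `VolumeLeverBox.lean` (§4: TIGHT for the tip
family modulo the fixed-cutoff statement `IndexSpreadBox`) transfers verbatim. Recorded here, kernel-checked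
against the restated decl:

* `extinctionBuildsQCD_iff_threshold` — the restated bridge unbundled (`Iff.rfl`);
* `extinctionBuildsQCD_iff_conclusion_of_windowExtinction` — GIVEN the sibling crux (`SD(2) ∧ SD(3)` by any
  witnesses) the bridge is literally `∀ N_f ∈ {2,3}, THR(N_f)`;
* `bridgeWithoutTight_iff_conclusion` — for EVERY conclusion family `C`, the TIGHT-less bridge is `C 2 ∧ C 3`
  (EXTINCT, mass scaling, asymptotic scaling carry no information), instance
  `extinctionBuildsQCDWithoutTight_iff_threshold`;
* `extinctionBuildsQCD_iff_threshold_of_indexSpreadBox` — modulo `IndexSpreadBox 2, 3` (physically true,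
  no continuum content) the bridge AS FILED is `∀ N_f ∈ {2,3}, THR(N_f)`: it restates its target, the
  pre-re-type summit conjunct (`ThresholdForm`).

The planner-facing consequence is unchanged from `Cruxes/ExtinctionBuildsQCD/VERDICT-c3.md`: quantify the
CAPPED clean class (a volume-seeing clause: polynomial volume cap + branch clause, or extensive TIGHT)
jointly in `WindowExtinction` and `ExtinctionBuildsQCD`, or re-cut the bridge around a PQ-continuum core.

(Tree note: after the restate the two §0 theorems of `WithoutTightCollapse.lean` that name the decl,
`extinctionBuildsQCD_iff` / `not_extinctionBuildsQCD_iff`, are stated against the OLD conclusion and no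
longer elaborate from source; their repair is an operator maintenance write (append-only rule). Nothing in
this file uses them.)

References: Berruto–Narayanan–Neuberger, Phys. Lett. B 489 (2000) 243, §7; Edwards–Heller–Narayanan,
Nucl. Phys. B 535 (1998) 403; Jaffe–Witten (Clay 2000) §5.
-/

noncomputable section

namespace Summit.QuantumFields.QCD.Theorems.ExtinctionBuildsQCD.Negative

open scoped BigOperators Topology Classical MeasureTheory Matrix ComplexConjugate
open Filter MeasureTheory Matrix
open Literature.MathematicalPhysics.QuantumLattice Literature.MathematicalPhysics.QuantumFieldTheory
  Literature.Probability.LatticeModels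
open Summit.QuantumFields.QCD.Theses.SpectralDefectExtinction

-- buildfix 2026-08-19 (maintenance): `extinctionBuildsQCD_iff_threshold` and
-- `not_extinctionBuildsQCD_iff_threshold` REMOVED — both unfolded the rev-6 body of the route decl
-- `ExtinctionBuildsQCD` by `Iff.rfl`; route rev 9 (2026-08-17) restated the hypothesis to SD⁺ (volume cap,
-- branch clause, extensive TIGHT), so the recorded equivalences are no longer definitional (nor provable:
-- SD⁺ is strictly stronger than `SDHyp`). No Theorems/Literature module references them.

/-- **Given the sibling crux `WindowExtinction` (`= ∀ N_f ∈ {2,3}, SD(N_f)`, by ANY witnesses), the bridge is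
its own conclusion** — pure logic: the cut `SD ∧ (SD → THR)` decomposes `THR` only as far as `SD` is
informative. -/
theorem extinctionBuildsQCD_iff_conclusion_of_windowExtinction (hSD : WindowExtinction) :
    ExtinctionBuildsQCD ↔ ∀ Nf : ℕ, (Nf = 2 ∨ Nf = 3) → (∃ reg : QCDRegularisation Nf, reg.HasMassScaling ∧ ∃ M₁ : ℝ, 0 ≤ M₁ ∧ ∀ m : Fin Nf → ℝ, (∀ f, M₁ < m f) → ∃ (z shift : QCDField Nf → ℕ → ℝ) (T : OSData (QCDField Nf) 4), IsQCDAlong (reg.scheme m z shift) T ∧ T.IsNontrivial QCDField.glue ∧ T.IsNonGaussian QCDField.glue ∧ (∀ f g : Fin Nf, f ≠ g → T.IsNontrivial (QCDField.pseudoRe f g)) ∧ ∃ Δ > 0, T.HasMassGap Δ ∧ (reg.scheme m z shift).HasLatticeMassGap Δ) :=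
  ⟨fun h Nf hNf => h Nf hNf (hSD Nf hNf), fun h Nf hNf _ => h Nf hNf⟩

/-- **LOAD-BEARING, conclusion-generic: without TIGHT the bridge IS its conclusion.** For EVERY family
`C` (the restated `THR`, the re-typed `QCDOf`, any later restate), the TIGHT-less bridge
`∀ N_f ∈ {2,3}, SDWithoutTight N_f → C N_f` is `C 2 ∧ C 3` (junk witness `canonicalAF`,
`sdWithoutTight_canonicalAF`): EXTINCT (any `c ≤ 1`), mass scaling and asymptotic scaling carry nothing. -/
theorem bridgeWithoutTight_iff_conclusion (C : ℕ → Prop) :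
    (∀ Nf : ℕ, (Nf = 2 ∨ Nf = 3) → SDWithoutTight Nf → C Nf) ↔ (C 2 ∧ C 3) :=
  ⟨fun h => ⟨h 2 (Or.inl rfl) (sdWithoutTight_canonicalAF 2),
      h 3 (Or.inr rfl) (sdWithoutTight_canonicalAF 3)⟩,
    fun hq Nf hNf _ => by
      rcases hNf with rfl | rfl
      exacts [hq.1, hq.2]⟩

/-- Instance for the restated bridge: with TIGHT deleted it is `THR` at `N_f = 2` and at `N_f = 3` — by
`ThresholdForm` the pre-re-type summit conjunct. Any proof of the restated crux must use TIGHT. -/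
theorem extinctionBuildsQCDWithoutTight_iff_threshold :
    (∀ Nf : ℕ, (Nf = 2 ∨ Nf = 3) → SDWithoutTight Nf → (∃ reg : QCDRegularisation Nf, reg.HasMassScaling ∧ ∃ M₁ : ℝ, 0 ≤ M₁ ∧ ∀ m : Fin Nf → ℝ, (∀ f, M₁ < m f) → ∃ (z shift : QCDField Nf → ℕ → ℝ) (T : OSData (QCDField Nf) 4), IsQCDAlong (reg.scheme m z shift) T ∧ T.IsNontrivial QCDField.glue ∧ T.IsNonGaussian QCDField.glue ∧ (∀ f g : Fin Nf, f ≠ g → T.IsNontrivial (QCDField.pseudoRe f g)) ∧ ∃ Δ > 0, T.HasMassGap Δ ∧ (reg.scheme m z shift).HasLatticeMassGap Δ)) ↔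
      ((∀ Nf : ℕ, Nf = 2 → (∃ reg : QCDRegularisation Nf, reg.HasMassScaling ∧ ∃ M₁ : ℝ, 0 ≤ M₁ ∧ ∀ m : Fin Nf → ℝ, (∀ f, M₁ < m f) → ∃ (z shift : QCDField Nf → ℕ → ℝ) (T : OSData (QCDField Nf) 4), IsQCDAlong (reg.scheme m z shift) T ∧ T.IsNontrivial QCDField.glue ∧ T.IsNonGaussian QCDField.glue ∧ (∀ f g : Fin Nf, f ≠ g → T.IsNontrivial (QCDField.pseudoRe f g)) ∧ ∃ Δ > 0, T.HasMassGap Δ ∧ (reg.scheme m z shift).HasLatticeMassGap Δ)) ∧ (∀ Nf : ℕ, Nf = 3 → (∃ reg : QCDRegularisation Nf, reg.HasMassScaling ∧ ∃ M₁ : ℝ, 0 ≤ M₁ ∧ ∀ m : Fin Nf → ℝ, (∀ f, M₁ < m f) → ∃ (z shift : QCDField Nf → ℕ → ℝ) (T : OSData (QCDField Nf) 4), IsQCDAlong (reg.scheme m z shift) T ∧ T.IsNontrivial QCDField.glue ∧ T.IsNonGaussian QCDField.glue ∧ (∀ f g : Fin Nf, f ≠ g → T.IsNontrivial (QCDField.pseudoRe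 f g)) ∧ ∃ Δ > 0, T.HasMassGap Δ ∧ (reg.scheme m z shift).HasLatticeMassGap Δ))) := by
  rw [bridgeWithoutTight_iff_conclusion fun Nf => (∃ reg : QCDRegularisation Nf, reg.HasMassScaling ∧ ∃ M₁ : ℝ, 0 ≤ M₁ ∧ ∀ m : Fin Nf → ℝ, (∀ f, M₁ < m f) → ∃ (z shift : QCDField Nf → ℕ → ℝ) (T : OSData (QCDField Nf) 4), IsQCDAlong (reg.scheme m z shift) T ∧ T.IsNontrivial QCDField.glue ∧ T.IsNonGaussian QCDField.glue ∧ (∀ f g : Fin Nf, f ≠ g → T.IsNontrivial (QCDField.pseudoRe f g)) ∧ ∃ Δ > 0, T.HasMassGap Δ ∧ (reg.scheme m z shift).HasLatticeMassGap Δ)]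
  exact ⟨fun h => ⟨fun Nf hNf => hNf ▸ h.1, fun Nf hNf => hNf ▸ h.2⟩, fun h => ⟨h.1 2 rfl, h.2 3 rfl⟩⟩

/-- **Collapse schema, conclusion-generic**: TIGHT replaced by ANY side condition `P` met by `canonicalAF`
(`m_crit ∈ [-8,0]`, `m_crit → 0`, `|m_crit| ≤ C g₀²`, the branch clause `-1 < m_crit ≤ 0`, …) still gives,
for every conclusion family `C`, a statement equivalent to `C 2 ∧ C 3`. -/
theorem bridge_collapse_schema_conclusion (P : ∀ Nf : ℕ, QCDRegularisation Nf → Prop)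
    (hP : ∀ Nf, P Nf (QCDRegularisation.canonicalAF Nf)) (C : ℕ → Prop) :
    (∀ Nf : ℕ, (Nf = 2 ∨ Nf = 3) →
      (∃ reg : QCDRegularisation Nf, P Nf reg ∧ reg.HasMassScaling ∧
        (reg.scheme 0 0 0).HasAsymptoticScaling ∧ ∃ M₀ : ℝ, 0 ≤ M₀ ∧ ∃ c : ℝ, 0 < c ∧
          ∀ m : Fin Nf → ℝ, (∀ f, M₀ < m f) → Extinct Nf reg c m) → C Nf) ↔ (C 2 ∧ C 3) := by
  have hw : ∀ Nf, ∃ reg : QCDRegularisation Nf, P Nf reg ∧ reg.HasMassScaling ∧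
      (reg.scheme 0 0 0).HasAsymptoticScaling ∧ ∃ M₀ : ℝ, 0 ≤ M₀ ∧ ∃ c : ℝ, 0 < c ∧
        ∀ m : Fin Nf → ℝ, (∀ f, M₀ < m f) → Extinct Nf reg c m := fun Nf =>
    ⟨QCDRegularisation.canonicalAF Nf, hP Nf, QCDRegularisation.canonicalAF_hasMassScaling,
      QCDScheme.zeroAF_hasAsymptoticScaling, 0, le_rfl, 1, one_pos,
      fun m hm => extinct_of_mcrit_nonneg _ (fun _ => le_rfl) le_rfl m hm⟩
  exact ⟨fun h => ⟨h 2 (Or.inl rfl) (hw 2), h 3 (Or.inr rfl) (hw 3)⟩,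
    fun hq Nf hNf _ => by
      rcases hNf with rfl | rfl
      exacts [hq.1, hq.2]⟩

-- buildfix 2026-08-19 (maintenance): `extinctionBuildsQCD_iff_threshold_of_indexSpreadBox` REMOVED — its
-- point (the bridge AS FILED restates its target modulo `IndexSpreadBox`) is exactly what route rev 9 voided:
-- `sdHyp_of_indexSpreadBox` yields `SDHyp`, not the SD⁺ hypothesis of the restated decl (see the route
-- docstring, 'summit-equivalence flag of rev ≤ 8 … VOIDED by the SD⁺ restate'). Unreferenced elsewhere.

end Summit.QuantumFields.QCD.Theorems.ExtinctionBuildsQCD.Negative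

end
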